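import Summits.QuantumFields.YangMills.Theorems.UnitScaleTiltProp7TwistedOneStepLinL1OfPlaqSmall
import Summits.QuantumFields.YangMills.Theorems.UnitScaleTiltProp7TwistedOneStepDefectOfRegPr
import HarnessLib

/-!
# Route `UnitScaleTilt`, crux K1 «MinimiserStabilityRegPr» (stmt-QuantumFields-19200), route-R E′ (A′) «HCOW-VIA-Σ» (★★OWNER RULING g28-№13), package P-A2 «JOINT-Σ», row F2″-COV —
# «F2″-COV AT THE MEMBER»: **THE ℓ¹ DAMPING OF THE COVARIANT ONE-STEP LINEARISATION ALONG THE AVERAGED BACKGROUND TOWER OF A PRINTED-REGULAR `U₀`, k-UNIFORM, L-ONLY CONSTANT**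
# `Σ_{c : PBond (F.P K) (l+1)} ‖(Df_l(0)·Y)(c)‖ ≤ (L⁻² + 2·10¹⁵·L³·ε₀)·Σ_b ‖Y b‖` for `RegPr F n K ε₀ U₀`, `10¹³L³ε₀ ≤ 1`, `l + 1 ≤ K − n` — the `hT`∕`κ` letter of px18 g3's
# ✓`Prop7CovLogTower.l1_CmapTwS_le_damped_defects` at the member, with `κ = L⁻²·(1 + 2·10¹⁵·L⁵·ε₀)` INDEPENDENT of the level `l < K − n` (at `ε₀ → 0`: print's `L^{1−d} = L⁻²`).

Cell `ym3-torus`, D-0154 (3c) twin-width seat `ym-routeR-w3` (gen 7); `--supports stmt-QuantumFields-19200 --as helper`, count-neutral; the MEMBER READING of this seat's FILE D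
✓`Prop7TwistedOneStepLinL1OfPlaqSmall.sum_norm_fderiv_dbarChartField_apply_le_of_plaqSmall`, through px15 g3's member rows ✓`Prop7TwistedOneStepDefectOfRegPr.member_rows` (the SAME
letters as the F1″ member row ✓`sum_norm_chartField_sub_fderiv_apply_le_of_regPr`: `a₀ := regThreshold F n K ε₀ = ε₀L^{−2(K−n)}`, `Ū₀ˡ = emlIterU l (bgUnits F K U₀)`, `s₀(l) ≤ 2700ε₀`).
YM₃ on T³ is a ladder rung (R3), NOT the Clay problem; nothing here is a claim about the stub, the crux, d = 4 or the mass gap; def-free.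

THE NUMERALS (d = 3, `ℓ = 5L`, `L ≥ 3`).  One-step budget at `ρ := (10⁷·(5L)²)⁻¹` (equality); `s₀(l) = 30·5L·(Lˡ·s_B) ≤ 150L·18ε₀∕L = 2700ε₀` (✓`level_read_le`), so `4s₀ < ρ ⟸ 1.08·10⁴·2.5·10⁸·L²·ε₀ < 1
⟸ 10¹³L³ε₀ ≤ 1`; the constant `L·L⁻³ + 16·(12Lρ)∕ρ²·(2s₀)·(2·3) = L⁻² + 2304·L·(2.5·10⁸L²)·s₀ ≤ L⁻² + 5.76·10¹¹·L³·2700ε₀ ≤ L⁻² + 2·10¹⁵·L³·ε₀`.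

WHAT THIS FILE PROVES (sorry-free, no definition).
* §1 `rho_budget_member`, `s0_lt_rho_member`, `constant_member_F2` — the three numerals above.
* §2 ★★★ **`sum_norm_fderiv_dbarChartField_apply_le_of_regPr`** — the member row; `differentiableAt_dbarChartField_zero_of_regPr` (F0″'s `hdiff` at the member, same window).
HONEST SCOPE.  Instantiation + numerals; constants crude (Cauchy∕Schwarz), L-only; the window `10¹³L³ε₀ ≤ 1` is stronger than F1″'s `10⁷L³ε₀ ≤ 1` (the damping must be CLOSE to `L⁻²`,
not merely finite) and F4″ will want `2·10¹⁵L⁵ε₀ ≤ q − 1` for its `κ ≤ q·L⁻²`.  Nothing of P-A2, hcoW∕hcoS, E′, EX or the crux is claimed.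

References: T. Bałaban, CMP **102** (1985) 277–309 [Balaban1985Variational] ((2) p.278, (44)–(46) p.285, (146) p.301); CMP **98** (1985) 17–51 [Balaban1985Averaging] ((89) p.31,
(125)–(127) p.36, (150)–(152) p.40); CMP **95** (1984) 17–40 [Balaban1984PropagatorsI] ((1.18)–(1.20) pp.19–20).
-/

noncomputable section

open scoped BigOperators Matrix.Norms.L2Operator
open NormedSpace Finset

namespace Summit.QuantumFields.YangMills.Theorems.Prop7TwistedOneStepLinL1OfRegPr

open Literature.MathematicalPhysics.QuantumFieldTheory.Balaban1983to89
open Literature.MathematicalPhysics.QuantumFieldTheory.Balaban1983to89.T3ContinuumYM3Torus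
open T4Continuum BlockAveraging MatrixLog
open T3PrintedRegularMinimiser (RegPr)
open T3RegularMinimiser (regThreshold regThreshold_pos)
open T3SectALandauChart (pos_of_regPr bgUnits)
open B7Prop1Explicit (expUnit)
open B10Eq27TorusAxialLog (unitsField toUField)
open Summit.QuantumFields.YangMills.Theorems.Prop8Chart (emlAvgU emlIterU)
open Summit.QuantumFields.YangMills.Theorems.Prop7SymAvgTwSym (dbarCovU)
open Summit.QuantumFields.YangMills.Theorems.Prop7TwistedOneStepDefectOfRegPr (level_read_le member_rows)
open Summit.QuantumFields.YangMills.Theorems.Prop7TwistedOneStepLinL1OfPlaqSmall (sum_norm_fderiv_dbarChartField_apply_le_of_plaqSmall differentiableAt_dbarChartField_zero_of_plaqSmall)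

/-! ## §1 Letter-free numerals -/

/-- The one-step budget at `ρ := (10⁷·(5L)²)⁻¹` (equality). [folklore] -/
theorem rho_budget_member {L : ℝ} (hL : 0 < L) : 10000000 * (5 * L) ^ 2 * (10000000 * (5 * L) ^ 2)⁻¹ ≤ 1 := by
  rw [mul_inv_cancel₀ (by positivity)]

/-- `4·s₀ < ρ` at the member: `s₀ ≤ 2700ε₀`, `10¹³L³ε₀ ≤ 1`, `L ≥ 3` ⇒ `4·(30·(5L)·p) < (10⁷(5L)²)⁻¹` for `p ≤ 18ε₀∕L`. [cite: Balaban1985Variational, (146) p.301] -/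
theorem s0_lt_rho_member {L ε₀ p : ℝ} (hL : 3 ≤ L) (hε₀ : 0 ≤ ε₀) (hε : 10 ^ 13 * L ^ 3 * ε₀ ≤ 1) (hp : p ≤ 18 * ε₀ / L) :
    4 * (30 * (5 * L) * p) < (10000000 * (5 * L) ^ 2)⁻¹ := by
  have hL0 : 0 < L := by linarith
  have hq : 30 * (5 * L) * p ≤ 2700 * ε₀ := by
    have := mul_le_mul_of_nonneg_left hp (by positivity : (0 : ℝ) ≤ 30 * (5 * L))
    have e : 30 * (5 * L) * (18 * ε₀ / L) = 2700 * ε₀ := by field_simp; ring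
    linarith
  rw [inv_eq_one_div, lt_div_iff₀ (by positivity)]
  -- `4·2700ε₀·2.5·10⁸L² = 2.7·10¹²L²ε₀ ≤ 0.27∕L < 1`
  have h1 : 4 * (30 * (5 * L) * p) * (10000000 * (5 * L) ^ 2) ≤ 2700000000000 * L ^ 2 * ε₀ := by nlinarith [sq_nonneg L]
  have h2 : 2700000000000 * L ^ 2 * ε₀ * (3 * L) ≤ 10 ^ 13 * L ^ 3 * ε₀ := by nlinarith [sq_nonneg L, mul_nonneg (sq_nonneg L) hε₀]
  have hA : 0 ≤ 2700000000000 * L ^ 2 * ε₀ := by positivity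
  have h9 : 2700000000000 * L ^ 2 * ε₀ * 9 ≤ 2700000000000 * L ^ 2 * ε₀ * (3 * L) := mul_le_mul_of_nonneg_left (by linarith) hA
  have h3 : 2700000000000 * L ^ 2 * ε₀ < 1 := by linarith
  linarith

/-- the constant at the member: `L·(L³)⁻¹ + 16·(12Lρ)∕ρ²·(2·(30·5L·p))·(2·3) ≤ L⁻¹² … ≤ (L^2)⁻¹ + 2·10¹⁵·L³·ε₀` at `ρ = (10⁷(5L)²)⁻¹`, `p ≤ 18ε₀∕L`, `L ≥ 3`.
[cite: Balaban1985Variational, (146) p.301] -/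
theorem constant_member_F2 {L ε₀ p : ℝ} (hL : 3 ≤ L) (hε₀ : 0 ≤ ε₀) (hp : p ≤ 18 * ε₀ / L) :
    L * (L ^ 3)⁻¹ + 16 * (12 * L * (10000000 * (5 * L) ^ 2)⁻¹) / ((10000000 * (5 * L) ^ 2)⁻¹) ^ 2 * (2 * (30 * (5 * L) * p)) * (2 * 3)
      ≤ (L ^ 2)⁻¹ + 2 * 10 ^ 15 * L ^ 3 * ε₀ := by
  have hL0 : 0 < L := by linarith
  have hq : 30 * (5 * L) * p ≤ 2700 * ε₀ := by
    have := mul_le_mul_of_nonneg_left hp (by positivity : (0 : ℝ) ≤ 30 * (5 * L))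
    have e : 30 * (5 * L) * (18 * ε₀ / L) = 2700 * ε₀ := by field_simp; ring
    linarith
  have e1 : L * (L ^ 3)⁻¹ = (L ^ 2)⁻¹ := by field_simp
  have e2 : 16 * (12 * L * (10000000 * (5 * L) ^ 2)⁻¹) / ((10000000 * (5 * L) ^ 2)⁻¹) ^ 2 * (2 * (30 * (5 * L) * p)) * (2 * 3) =
      2304 * L * (10000000 * (5 * L) ^ 2) * (30 * (5 * L) * p) := by
    field_simp
    ring
  rw [e1, e2]
  have h3 : 2304 * L * (10000000 * (5 * L) ^ 2) * (30 * (5 * L) * p) ≤ 2304 * L * (10000000 * (5 * L) ^ 2) * (2700 * ε₀) :=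
    mul_le_mul_of_nonneg_left hq (by positivity)
  nlinarith [pow_nonneg hL0.le 3, mul_nonneg (pow_nonneg hL0.le 3) hε₀]

/-! ## §2 The member reading -/

variable (F : T3Family) (n K : ℕ)
variable {F n K}

/-- ★★★ **F2″-COV AT THE MEMBER, k-UNIFORM**: for a member `(F, n, K)` of the `d = 3` family, a printed-regular background `RegPr F n K ε₀ U₀` with `10¹³L³ε₀ ≤ 1`, and a level
`l + 1 ≤ K − n`: the linear part `T_l := Df_l(0)` of the one-step covariant twisted average in log coordinates at `Ū₀ˡ = emlIterU l (bgUnits F K U₀)` (px18 g3's `Φ`, INLINE) has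
column sums `Σ_{c : PBond (F.P K) (l+1)} ‖(fderiv ℂ (y ↦ (c ↦ f_l(y)(c))) 0 Y) c‖ ≤ ((L²)⁻¹ + 2·10¹⁵·L³·ε₀)·Σ_b ‖Y b‖` — `κ = L⁻²(1 + 2·10¹⁵L⁵ε₀)`, the same for every `l`.
[cite: Balaban1985Variational, (2) p.278, (44)-(46) p.285, (146) p.301; Balaban1985Averaging, (125)-(127) p.36, (150)-(152) p.40; Balaban1984PropagatorsI, (1.18)-(1.20) pp.19-20] -/
theorem sum_norm_fderiv_dbarChartField_apply_le_of_regPr {ε₀ : ℝ} (hε : 10 ^ 13 * (F.L : ℝ) ^ 3 * ε₀ ≤ 1)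
    {U₀ : GaugeField (F.P K) 0 (Matrix.specialUnitaryGroup (Fin 2) ℂ)} (hreg : RegPr F n K ε₀ U₀) {l : ℕ} (hl : l + 1 ≤ K - n)
    (Y : PBond (F.P K) l → Matrix (Fin 2) (Fin 2) ℂ) :
    ∑ c : PBond (F.P K) (l + 1), ‖(fderiv ℂ (fun (y : PBond (F.P K) l → Matrix (Fin 2) (Fin 2) ℂ) (c : PBond (F.P K) (l + 1)) =>
        mlog (((dbarCovU (emlIterU l (bgUnits F K U₀)) (fun b => expUnit (y b) * emlIterU l (bgUnits F K U₀) b) c :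
            (Matrix (Fin 2) (Fin 2) ℂ)ˣ) : Matrix (Fin 2) (Fin 2) ℂ) *
          (((emlAvgU (emlIterU l (bgUnits F K U₀)) c)⁻¹ : (Matrix (Fin 2) (Fin 2) ℂ)ˣ) : Matrix (Fin 2) (Fin 2) ℂ))) 0 Y) c‖ ≤
      (((F.L : ℝ) ^ 2)⁻¹ + 2 * 10 ^ 15 * (F.L : ℝ) ^ 3 * ε₀) * ∑ b : PBond (F.P K) l, ‖Y b‖ := by
  have hε₀ : 0 < ε₀ := pos_of_regPr F hreg
  have hL3 : (3 : ℝ) ≤ F.L := by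
    have : 3 ≤ F.L := by obtain ⟨a, ha⟩ := F.hL.1; have := F.hL.2; omega
    exact_mod_cast this
  have hL1 : (1 : ℝ) ≤ F.L := by linarith
  have hL0 : (0 : ℝ) < F.L := by linarith
  have hε7 : 10 ^ 7 * (F.L : ℝ) ^ 3 * ε₀ ≤ 1 := by
    have : 10 ^ 7 * (F.L : ℝ) ^ 3 * ε₀ ≤ 10 ^ 13 * (F.L : ℝ) ^ 3 * ε₀ := by
      have : (0 : ℝ) ≤ (F.L : ℝ) ^ 3 * ε₀ := by positivity
      nlinarith
    linarith
  rw [show bgUnits F K U₀ = unitsField (toUField U₀) from rfl]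
  obtain ⟨hl2, ha₀, -, -, hbud₀, -, -⟩ := member_rows (F := F) (n := n) (K := K) (s := 0) hε7 hreg hl (by simp)
  have hd : (F.P K).d = 3 := T3Family.P_d F K
  have hLn : ((F.P K).L : ℝ) = F.L := rfl
  -- the level read `p := Lˡ·s_B ≤ 18ε₀∕L`
  have hp : ((F.P K).L : ℝ) ^ l * (2 * (((F.P K).d : ℝ) * (3 * ((F.P K).L : ℝ) ^ (l + 1) - 1)) * regThreshold F n K ε₀) ≤ 18 * ε₀ / F.L := by
    rw [hd, hLn]
    unfold regThreshold
    push_cast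
    exact level_read_le hL1 hε₀.le hl
  have hp0 : 0 ≤ ((F.P K).L : ℝ) ^ l * (2 * (((F.P K).d : ℝ) * (3 * ((F.P K).L : ℝ) ^ (l + 1) - 1)) * regThreshold F n K ε₀) := by
    rw [hLn]
    have h3 : (0 : ℝ) ≤ 3 * (F.L : ℝ) ^ (l + 1) - 1 := by linarith [one_le_pow₀ (M₀ := ℝ) (n := l + 1) hL1]
    have : (0 : ℝ) ≤ ((F.P K).d : ℝ) := Nat.cast_nonneg _
    have := ha₀.le
    positivity
  have hρ0 : (0 : ℝ) < (10000000 * (5 * (F.L : ℝ)) ^ 2)⁻¹ := by positivity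
  have hbudget : 10000000 * ((((F.P K).d + 2) * (F.P K).L : ℕ) : ℝ) ^ 2 * (10000000 * (5 * (F.L : ℝ)) ^ 2)⁻¹ ≤ 1 := by
    rw [hd]; push_cast; rw [hLn]
    exact rho_budget_member hL0
  have hs₀ρ : 4 * (30 * ((((F.P K).d + 2) * (F.P K).L : ℕ) : ℝ) * ((F.P K).L : ℝ) ^ l *
      (2 * (((F.P K).d : ℝ) * (3 * ((F.P K).L : ℝ) ^ (l + 1) - 1)) * regThreshold F n K ε₀)) < (10000000 * (5 * (F.L : ℝ)) ^ 2)⁻¹ := by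
    have h := s0_lt_rho_member hL3 hε₀.le hε hp
    have e : 30 * ((((F.P K).d + 2) * (F.P K).L : ℕ) : ℝ) * ((F.P K).L : ℝ) ^ l *
        (2 * (((F.P K).d : ℝ) * (3 * ((F.P K).L : ℝ) ^ (l + 1) - 1)) * regThreshold F n K ε₀)
        = 30 * (5 * (F.L : ℝ)) * (((F.P K).L : ℝ) ^ l * (2 * (((F.P K).d : ℝ) * (3 * ((F.P K).L : ℝ) ^ (l + 1) - 1)) * regThreshold F n K ε₀)) := by
      rw [hd]; push_cast; rw [hLn]; ring
    rw [e]; exact h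
  have hC := constant_member_F2 hL3 hε₀.le hp
  have hrow := sum_norm_fderiv_dbarChartField_apply_le_of_plaqSmall (P := F.P K) hl2 U₀ ha₀ hreg.plaqSmall hbud₀ hρ0 hbudget hs₀ρ Y
  have e : ((F.P K).L : ℝ) * (((F.P K).L : ℝ) ^ (F.P K).d)⁻¹ +
      16 * (12 * ((F.P K).L : ℝ) * (10000000 * (5 * (F.L : ℝ)) ^ 2)⁻¹) / ((10000000 * (5 * (F.L : ℝ)) ^ 2)⁻¹) ^ 2 *
        (2 * (30 * ((((F.P K).d + 2) * (F.P K).L : ℕ) : ℝ) * ((F.P K).L : ℝ) ^ l *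
          (2 * (((F.P K).d : ℝ) * (3 * ((F.P K).L : ℝ) ^ (l + 1) - 1)) * regThreshold F n K ε₀))) * (2 * ((F.P K).d : ℝ))
      = (F.L : ℝ) * ((F.L : ℝ) ^ 3)⁻¹ + 16 * (12 * (F.L : ℝ) * (10000000 * (5 * (F.L : ℝ)) ^ 2)⁻¹) / ((10000000 * (5 * (F.L : ℝ)) ^ 2)⁻¹) ^ 2 *
        (2 * (30 * (5 * (F.L : ℝ)) * (((F.P K).L : ℝ) ^ l * (2 * (((F.P K).d : ℝ) * (3 * ((F.P K).L : ℝ) ^ (l + 1) - 1)) * regThreshold F n K ε₀)))) * (2 * 3) := by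
    rw [hd]; push_cast; rw [hLn]; ring
  rw [e] at hrow
  exact hrow.trans (mul_le_mul_of_nonneg_right hC (Finset.sum_nonneg fun b _ => norm_nonneg _))

/-- **THE FIELD-VALUED ONE-STEP CHART AT `Ū₀ˡ` IS DIFFERENTIABLE AT `0` AT THE MEMBER** (F0″'s `hdiff`), same window. [cite: Balaban1985Averaging, (127) p.36; Balaban1987RG1, (0.4) p.253] -/
theorem differentiableAt_dbarChartField_zero_of_regPr {ε₀ : ℝ} (hε : 10 ^ 13 * (F.L : ℝ) ^ 3 * ε₀ ≤ 1)
    {U₀ : GaugeField (F.P K) 0 (Matrix.specialUnitaryGroup (Fin 2) ℂ)} (hreg : RegPr F n K ε₀ U₀) {l : ℕ} (hl : l + 1 ≤ K - n) :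
    DifferentiableAt ℂ (fun (y : PBond (F.P K) l → Matrix (Fin 2) (Fin 2) ℂ) (c : PBond (F.P K) (l + 1)) =>
        mlog (((dbarCovU (emlIterU l (bgUnits F K U₀)) (fun b => expUnit (y b) * emlIterU l (bgUnits F K U₀) b) c :
            (Matrix (Fin 2) (Fin 2) ℂ)ˣ) : Matrix (Fin 2) (Fin 2) ℂ) *
          (((emlAvgU (emlIterU l (bgUnits F K U₀)) c)⁻¹ : (Matrix (Fin 2) (Fin 2) ℂ)ˣ) : Matrix (Fin 2) (Fin 2) ℂ))) 0 := by
  have hε₀ : 0 < ε₀ := pos_of_regPr F hreg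
  have hL3 : (3 : ℝ) ≤ F.L := by
    have : 3 ≤ F.L := by obtain ⟨a, ha⟩ := F.hL.1; have := F.hL.2; omega
    exact_mod_cast this
  have hL1 : (1 : ℝ) ≤ F.L := by linarith
  have hL0 : (0 : ℝ) < F.L := by linarith
  have hε7 : 10 ^ 7 * (F.L : ℝ) ^ 3 * ε₀ ≤ 1 := by
    have : 10 ^ 7 * (F.L : ℝ) ^ 3 * ε₀ ≤ 10 ^ 13 * (F.L : ℝ) ^ 3 * ε₀ := by
      have : (0 : ℝ) ≤ (F.L : ℝ) ^ 3 * ε₀ := by positivity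
      nlinarith
    linarith
  rw [show bgUnits F K U₀ = unitsField (toUField U₀) from rfl]
  obtain ⟨hl2, ha₀, -, -, hbud₀, -, -⟩ := member_rows (F := F) (n := n) (K := K) (s := 0) hε7 hreg hl (by simp)
  have hd : (F.P K).d = 3 := T3Family.P_d F K
  have hLn : ((F.P K).L : ℝ) = F.L := rfl
  have hp : ((F.P K).L : ℝ) ^ l * (2 * (((F.P K).d : ℝ) * (3 * ((F.P K).L : ℝ) ^ (l + 1) - 1)) * regThreshold F n K ε₀) ≤ 18 * ε₀ / F.L := by
    rw [hd, hLn]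
    unfold regThreshold
    push_cast
    exact level_read_le hL1 hε₀.le hl
  have hρ0 : (0 : ℝ) < (10000000 * (5 * (F.L : ℝ)) ^ 2)⁻¹ := by positivity
  have hbudget : 10000000 * ((((F.P K).d + 2) * (F.P K).L : ℕ) : ℝ) ^ 2 * (10000000 * (5 * (F.L : ℝ)) ^ 2)⁻¹ ≤ 1 := by
    rw [hd]; push_cast; rw [hLn]
    exact rho_budget_member hL0
  have hs₀ρ : 4 * (30 * ((((F.P K).d + 2) * (F.P K).L : ℕ) : ℝ) * ((F.P K).L : ℝ) ^ l *
      (2 * (((F.P K).d : ℝ) * (3 * ((F.P K).L : ℝ) ^ (l + 1) - 1)) * regThreshold F n K ε₀)) < (10000000 * (5 * (F.L : ℝ)) ^ 2)⁻¹ := by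
    have h := s0_lt_rho_member hL3 hε₀.le hε hp
    have e : 30 * ((((F.P K).d + 2) * (F.P K).L : ℕ) : ℝ) * ((F.P K).L : ℝ) ^ l *
        (2 * (((F.P K).d : ℝ) * (3 * ((F.P K).L : ℝ) ^ (l + 1) - 1)) * regThreshold F n K ε₀)
        = 30 * (5 * (F.L : ℝ)) * (((F.P K).L : ℝ) ^ l * (2 * (((F.P K).d : ℝ) * (3 * ((F.P K).L : ℝ) ^ (l + 1) - 1)) * regThreshold F n K ε₀)) := by
      rw [hd]; push_cast; rw [hLn]; ring
    rw [e]; exact h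
  exact differentiableAt_dbarChartField_zero_of_plaqSmall (P := F.P K) hl2 U₀ ha₀ hreg.plaqSmall hbud₀ hρ0 hbudget hs₀ρ

end Summit.QuantumFields.YangMills.Theorems.Prop7TwistedOneStepLinL1OfRegPr

end
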